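import Mathlib.Data.Real.Basic
import Mathlib.Tactic.Linarith
import Mathlib.Tactic.Positivity
import Mathlib.Tactic.FieldSimp
import Mathlib.Tactic.Ring
import Mathlib.Tactic.NormNum
import HarnessLib

/-!
# The Euler correction `ψ(m) = ∏_{p | m}(1 + 1/p)` of the KMV mollifier is the optimal one (local factors)

Topic `Literature/NumberTheory/LFunctions` (namespace
`Literature.NumberTheory.LFunctions.MollifierEulerCorrection`). PROVED, elementary algebra over `ℝ`;
no named facts are introduced (D-0026). Typed for the cell `landau-siegel` (rung F-S3, sub-cell
§B-fam), in support of the C0⁺ / famE-09 row («one-piece optimality over arbitrary coefficients»,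
`KMV2000.LinearMollifierOptimality`) of `B-fam/PLAN.md` and of the probe `B-fam/num-1/Q08-PROBE.md`
§2 — a DERIVATION about the objects of the cited source, labelled as such in every docstring.

## What the source prints (held text, read 2026-08-26)

E. Kowalski, P. Michel, J. VanderKam, *Non-vanishing of high derivatives of automorphic
`L`-functions at the center of the critical strip*, J. reine angew. Math. 526 (2000) 1–34
[held: `paper:doi-10-1515-crll-2000-074`]. The mollifier (9), p. 7, is
`M_P(f) = Σ_{m<M} λ_f(m) μ(m) ψ(m)⁻¹ m^{-1/2} P(log(M/m)/log M)` with `ψ(m) = ∏_{p|m}(1 + 1/p)` (8)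
(«the function `ψ` accounts for the degree two portion of the Euler factors», p. 7). In the
evaluation of the first and second harmonic mollified moments the arithmetic of the coefficients
enters only through two convergent Euler products: `η₁(0,0,0) = ζ(2)` (p. 11, giving the constant
of (20)) and `η₂(0,0,0,0,0) = ζ(2)²` (pp. 15–16, giving the constant of Prop 5.1, p. 18), so that
the ratio (32) of Theorem 6.1 is free of arithmetic constants.

## What is typed here (derivation)

Replace `ψ(m)⁻¹` in (9) by a general multiplicative correction `g` (value `g(p) = t` at the prime
`p`; `t = p/(p+1)` is KMV's choice). Redoing the residue computation of §4.1/§5.1 with the local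
Euler factors of `Σ_m μ(m) g(m) m^{-1-s}` (first moment) and of
`Σ_{m₁,m₂} μ(m₁)μ(m₂) g(m₁)g'(m₂) (m₁m₂)^{-1} Σ_{c|(m₁,m₂)} c·τ(m₁m₂/c²) (c²/m₁m₂)^w` (second moment,
diagonal (23)) against `ζ(1+s)⁻¹` resp. `ζ(1+s₁+s₂) ζ(1+s₁+w)⁻² ζ(1+s₂+w)⁻²` gives, at the prime `p`,
the LOCAL FACTORS
* `firstLocal p t  := (1 − t/p)/(1 − 1/p)`                      (so `η₁ = ∏_p firstLocal p (g p)`),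
* `secondLocal p t t' := (1 − 2t/p − 2t'/p + t t'(1/p + 3/p²))/(1 − 1/p)³` (so `η₂ = ∏_p secondLocal`),
and the leading order of KMV's ratio for the design `μ·g·P` is
`(η₁(g)²/η₂(g,g)) · P′(1)²/(2(P′(1)² + Δ⁻¹∫P″²))`. This file proves the prime-by-prime statement
behind «`ψ` is optimal»:
* `secondLocal_sub_firstLocal_sq` : the IDENTITY
  `secondLocal p t t · (1−1/p)³ − (firstLocal p t)²·(1−1/p)³ = (1/p)·(1 − t(p+1)/p)²` in polynomial
  form, i.e. `(1 − 4t/p + t²(1/p+3/p²)) − (1 − t/p)²(1 − 1/p) = (1/p)(1 − t(p+1)/p)²`;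
* `firstLocal_sq_le_secondLocal` : for `p > 1` and every real `t`,
  `(firstLocal p t)² ≤ secondLocal p t t` — the local ratio is `≤ 1`;
* `firstLocal_sq_eq_secondLocal_iff` : equality holds iff `t = p/(p+1) = 1/ψ(p)`;
* `secondLocal_pos` : `secondLocal p t t > 0` for `p > 1` (the second-moment local form is definite);
* `firstLocal_psi`, `secondLocal_psi` : at `t = p/(p+1)` the factors are `p²/(p²−1)` and
  `(p²/(p²−1))²` — the Euler factors of `ζ(2)` and `ζ(2)²`, i.e. exactly KMV's constants.
Consequence used by the cell (stated, not typed here: it needs the moment forms with a `g`-slot):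
both leading-order forms are tensor products over the primes of these local forms with the profile
forms of Theorem 6.1, and the linear form is a pure tensor, so the Rayleigh supremum over every
coefficient array `x_m = μ(m)·F(m, log(M/m)/log M)` with `F` in the span of
(multiplicative function) × (profile) is the product of the local suprema `= 1` times the profile
supremum — KMV's `ψ⁻¹ · x²` is the leading-order optimum over that whole span
(`OnePieceMollifierCeiling.propIS_le` is the profile half). WHAT THIS IS NOT: not a statement about
coefficient arrays outside that span (anatomy-dependent designs), not a statement about the
family beyond the main-term model, nothing about Landau–Siegel zeros.

## References

* [KowalskiMichelVanderKam2000] (8)–(9) p. 7; η₁ = ζ(2) p. 11 and (20); η₂ = ζ(2)² pp. 15–16;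
  Prop 5.1 p. 18; Thm 6.1 (32) p. 20 (held).
-/

namespace Literature.NumberTheory.LFunctions.MollifierEulerCorrection

/-- Local factor at the prime `p` of the FIRST mollified moment for a multiplicative coefficient
correction with value `t` at `p` (KMV: `t = 1/ψ(p) = p/(p+1)`): `(1 − t/p)/(1 − 1/p)`, the
`p`-factor of `(Σ_m μ(m)g(m)m^{-1-s})·ζ(1+s)` at `s = 0`.
[cite: KowalskiMichelVanderKam2000, §4.1 p. 11 (η₁(0,0,0) = ζ(2)) with (8)–(9) p. 7 (derivation: general g in place of 1/ψ)] -/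
noncomputable def firstLocal (p t : ℝ) : ℝ := (1 - t / p) / (1 - 1 / p)

/-- Local factor at the prime `p` of the (diagonal) SECOND mollified moment for multiplicative
corrections with values `t, t'` at `p` in the two mollifier copies:
`(1 − 2t/p − 2t'/p + t t'(1/p + 3/p²))/(1 − 1/p)³`, the `p`-factor of the coefficient Dirichlet
series of (23) against `ζ(1+s₁+s₂)ζ(1+s₁+w)⁻²ζ(1+s₂+w)⁻²` at the origin (the `3/p²` is `τ(p²)`,
the `t t'/p` is the `c = p` term `c·τ(1)`).
[cite: KowalskiMichelVanderKam2000, §5.1 pp. 13–16 (η₂(0,…,0) = ζ(2)²) with (23) p. 13 (derivation: general g)] -/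
noncomputable def secondLocal (p t t' : ℝ) : ℝ :=
  (1 - 2 * t / p - 2 * t' / p + t * t' * (1 / p + 3 / p ^ 2)) / (1 - 1 / p) ^ 3

/-- **The completing-the-square identity** behind the optimality of `ψ`: for `p ≠ 0`,
`(1 − 4t/p + t²(1/p + 3/p²)) − (1 − t/p)²(1 − 1/p) = (1/p)·(1 − t(p+1)/p)²`.
[cite: KowalskiMichelVanderKam2000, (8)–(9) p. 7 («ψ accounts for the degree two portion of the Euler factors») (derivation)] -/
theorem numerator_identity (p t : ℝ) (hp : p ≠ 0) :
    (1 - 2 * t / p - 2 * t / p + t * t * (1 / p + 3 / p ^ 2)) - (1 - t / p) ^ 2 * (1 - 1 / p)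
      = (1 / p) * (1 - t * (p + 1) / p) ^ 2 := by
  field_simp
  ring

/-- **Definiteness of the local second-moment form**: for `p > 1` and every real `t`,
`secondLocal p t t > 0`.
[cite: KowalskiMichelVanderKam2000, Prop 5.1 p. 18 (positivity of the second moment main term) (derivation: local form)] -/
theorem secondLocal_pos (p t : ℝ) (hp : 1 < p) : 0 < secondLocal p t t := by
  unfold secondLocal
  have hp0 : 0 < p := by linarith
  have hp' : p ≠ 0 := ne_of_gt hp0
  have hden : 0 < (1 - 1 / p) ^ 3 := by
    have : 0 < 1 - 1 / p := by
      rw [sub_pos, div_lt_one hp0]; exact hp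
    positivity
  apply div_pos _ hden
  -- numerator = (1 - t/p)²(1 - 1/p) + (1/p)(1 - t(p+1)/p)²  > 0
  have hid := numerator_identity p t hp'
  have h1 : 0 ≤ (1 - t / p) ^ 2 * (1 - 1 / p) := by
    have : 0 ≤ 1 - 1 / p := by
      have : 1 / p < 1 := by rw [div_lt_one hp0]; exact hp
      linarith
    positivity
  have h2 : 0 ≤ (1 / p) * (1 - t * (p + 1) / p) ^ 2 := by positivity
  -- the two squares cannot vanish simultaneously: (1 - t/p) = 0 forces t = p, and then 1 - t(p+1)/p = -p ≠ 0
  by_cases ht : 1 - t / p = 0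
  · have htp : t = p := by
      have : t / p = 1 := by linarith
      field_simp at this; linarith
    have h3 : 0 < (1 / p) * (1 - t * (p + 1) / p) ^ 2 := by
      have hne : 1 - t * (p + 1) / p ≠ 0 := by
        rw [htp]; field_simp; linarith
      have : 0 < (1 - t * (p + 1) / p) ^ 2 := by positivity
      positivity
    linarith
  · have h3 : 0 < (1 - t / p) ^ 2 * (1 - 1 / p) := by
      have hsq : 0 < (1 - t / p) ^ 2 := by positivity
      have : 0 < 1 - 1 / p := by
        rw [sub_pos, div_lt_one hp0]; exact hp
      positivity
    linarith

/-- **The local ratio is at most one**: for `p > 1` and every real `t`,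
`(firstLocal p t)² ≤ secondLocal p t t`; equivalently the arithmetic constant `η₁(g)²/η₂(g,g)` of
the leading-order KMV ratio is a product of local factors each `≤ 1`.
[cite: KowalskiMichelVanderKam2000, Thm 6.1 (32) p. 20 with (8)–(9) p. 7 (derivation: optimality of the Euler correction ψ)] -/
theorem firstLocal_sq_le_secondLocal (p t : ℝ) (hp : 1 < p) :
    (firstLocal p t) ^ 2 ≤ secondLocal p t t := by
  unfold firstLocal secondLocal
  have hp0 : 0 < p := by linarith
  have hp' : p ≠ 0 := ne_of_gt hp0
  have hq : 0 < 1 - 1 / p := by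
    rw [sub_pos, div_lt_one hp0]; exact hp
  have hq' : (1 - 1 / p) ≠ 0 := ne_of_gt hq
  rw [div_pow, div_le_div_iff₀ (by positivity) (by positivity)]
  -- goal: (1 - t/p)^2 * (1 - 1/p)^3 ≤ (1 - 2t/p - 2t/p + t t (1/p + 3/p²)) * (1 - 1/p)^2
  have hid := numerator_identity p t hp'
  have hsq : 0 ≤ (1 / p) * (1 - t * (p + 1) / p) ^ 2 := by positivity
  have hq2 : 0 ≤ (1 - 1 / p) ^ 2 := by positivity
  have key : (1 - 2 * t / p - 2 * t / p + t * t * (1 / p + 3 / p ^ 2)) * (1 - 1 / p) ^ 2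
      - (1 - t / p) ^ 2 * (1 - 1 / p) ^ 3
      = ((1 / p) * (1 - t * (p + 1) / p) ^ 2) * (1 - 1 / p) ^ 2 := by
    have : (1 - t / p) ^ 2 * (1 - 1 / p) ^ 3 = ((1 - t / p) ^ 2 * (1 - 1 / p)) * (1 - 1 / p) ^ 2 := by
      ring
    rw [this, ← sub_mul, hid]
  nlinarith [mul_nonneg hsq hq2, key]

/-- **Equality exactly at KMV's choice**: for `p > 1`, `(firstLocal p t)² = secondLocal p t t`
iff `t = p/(p+1) = 1/ψ(p)`.
[cite: KowalskiMichelVanderKam2000, (8)–(9) p. 7 (ψ(p) = 1 + 1/p) (derivation: uniqueness of the optimal Euler correction)] -/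
theorem firstLocal_sq_eq_secondLocal_iff (p t : ℝ) (hp : 1 < p) :
    (firstLocal p t) ^ 2 = secondLocal p t t ↔ t = p / (p + 1) := by
  unfold firstLocal secondLocal
  have hp0 : 0 < p := by linarith
  have hp' : p ≠ 0 := ne_of_gt hp0
  have hp1 : p + 1 ≠ 0 := by
    have : 0 < p + 1 := by linarith
    exact ne_of_gt this
  have hq : 0 < 1 - 1 / p := by
    rw [sub_pos, div_lt_one hp0]; exact hp
  have hq' : (1 - 1 / p) ≠ 0 := ne_of_gt hq
  have hid := numerator_identity p t hp'
  constructor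
  · intro h
    rw [div_pow, div_eq_div_iff (by positivity) (by positivity)] at h
    -- h : (1 - t/p)^2 * (1-1/p)^3 = (numerator) * (1-1/p)^2
    have h' : ((1 - 2 * t / p - 2 * t / p + t * t * (1 / p + 3 / p ^ 2)) - (1 - t / p) ^ 2 * (1 - 1 / p))
        * (1 - 1 / p) ^ 2 = 0 := by
      have : (1 - t / p) ^ 2 * (1 - 1 / p) ^ 3 = ((1 - t / p) ^ 2 * (1 - 1 / p)) * (1 - 1 / p) ^ 2 := by
        ring
      rw [this] at h
      linarith
    rw [hid] at h'
    have hq2 : (1 - 1 / p) ^ 2 ≠ 0 := pow_ne_zero 2 hq'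
    have h'' : (1 / p) * (1 - t * (p + 1) / p) ^ 2 = 0 := by
      rcases mul_eq_zero.mp h' with h3 | h3
      · exact h3
      · exact absurd h3 hq2
    have h3 : (1 - t * (p + 1) / p) ^ 2 = 0 := by
      rcases mul_eq_zero.mp h'' with h4 | h4
      · exfalso; exact hp' (by simpa using h4)
      · exact h4
    have h4 : 1 - t * (p + 1) / p = 0 := pow_eq_zero_iff (n := 2) (by norm_num) |>.mp h3
    have h5 : t * (p + 1) = p := by
      have : t * (p + 1) / p = 1 := by linarith
      field_simp at this
      linarith
    field_simp
    linarith
  · intro ht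
    rw [ht, div_pow, div_eq_div_iff (by positivity) (by positivity)]
    field_simp
    ring

/-- **KMV's constants recovered**: at `t = 1/ψ(p) = p/(p+1)` the first local factor is the
Euler factor of `ζ(2)`, `p²/(p²−1) = (1 − p⁻²)⁻¹` — hence `η₁ = ζ(2)` in (20).
[cite: KowalskiMichelVanderKam2000, §4.1 p. 11 (η₁(0,0,0) = ζ(2))] -/
theorem firstLocal_psi (p : ℝ) (hp : 1 < p) : firstLocal p (p / (p + 1)) = p ^ 2 / (p ^ 2 - 1) := by
  unfold firstLocal
  have hp0 : 0 < p := by linarith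
  have hp' : p ≠ 0 := ne_of_gt hp0
  have hp1 : p + 1 ≠ 0 := ne_of_gt (by linarith)
  have hpm : p - 1 ≠ 0 := ne_of_gt (by linarith)
  have hp2 : p ^ 2 - 1 ≠ 0 := by
    have : p ^ 2 - 1 = (p - 1) * (p + 1) := by ring
    rw [this]; exact mul_ne_zero hpm hp1
  have hq' : (1 - 1 / p) ≠ 0 := by
    rw [sub_ne_zero]; intro h
    have : p = 1 := by field_simp at h; linarith
    linarith
  rw [div_eq_div_iff hq' hp2]
  field_simp
  ring

/-- **KMV's constants recovered (second moment)**: at `t = t' = 1/ψ(p)` the second local factor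
is `(p²/(p²−1))²`, the Euler factor of `ζ(2)²` — hence `η₂ = ζ(2)²` in Prop 5.1, and the local
ratio `firstLocal²/secondLocal` equals `1` (the bound of `firstLocal_sq_le_secondLocal` is attained).
[cite: KowalskiMichelVanderKam2000, §5.1 pp. 15–16 (η₂(0,0,0,0,0) = ζ(2)²), Prop 5.1 p. 18] -/
theorem secondLocal_psi (p : ℝ) (hp : 1 < p) :
    secondLocal p (p / (p + 1)) (p / (p + 1)) = (p ^ 2 / (p ^ 2 - 1)) ^ 2 := by
  rw [← firstLocal_psi p hp]
  exact ((firstLocal_sq_eq_secondLocal_iff p (p / (p + 1)) hp).mpr rfl).symm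

/-- **Plain Möbius coefficients are worse by the factor `1 + 1/(p−1)³` at each prime**: with no
Euler correction (`t = 1`) the local ratio is `secondLocal/firstLocal² = 1 + 1/(p−1)³`
(product over primes `≈ 2.30`), quantifying why (9) carries `ψ(m)⁻¹`.
[cite: KowalskiMichelVanderKam2000, (8)–(9) p. 7 (derivation: the uncorrected mollifier)] -/
theorem ratio_at_one (p : ℝ) (hp : 1 < p) :
    secondLocal p 1 1 = (1 + 1 / (p - 1) ^ 3) * (firstLocal p 1) ^ 2 := by
  unfold firstLocal secondLocal
  have hp0 : 0 < p := by linarith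
  have hp' : p ≠ 0 := ne_of_gt hp0
  have hpm : p - 1 ≠ 0 := ne_of_gt (by linarith)
  have hq' : (1 - 1 / p) ≠ 0 := by
    rw [sub_ne_zero]; intro h
    have : p = 1 := by field_simp at h; linarith
    linarith
  field_simp
  ring

end Literature.NumberTheory.LFunctions.MollifierEulerCorrection
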